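import Mathlib
import HarnessLib
import Summits.NavierStokesRegularity.NavierStokesRegularity.Theorems.ChiralWindowDoorDefs

/-!
# Door S20 «ChiralWindowDoor» — `Λ = (−Δ)^{1/2}` in second-difference form is a GENUINE Bochner integral on `C²_b`
# fields (nsreg-p1 `r19/SecondDiff.lean` + `r19/LambdaWellDefined.lean`, landed)

Door S20 of nsreg-p1's local Type-I door family (`HOME/ns-regularity-ideate-p1/r19/ROUND-19-DRAFT.md`, `R19-LINE.md`
§PROVED-5; DESIGN-ONLY, route NOT born).  The substrate's `fracLapHalf f x = ½ ∫ lamK z • (2f(x) − f(x+z) − f(x−z)) dz`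
(`…Theorems.ChiralWindowDoorDefs`) is a Bochner integral, junk value `0` when the integrand is not integrable.  Here:

* `norm_secondDiff_le` (general normed spaces) — `ContDiff ℝ 2 f`, `‖D(Df)‖ ≤ M₂` ⇒ `‖2f(x) − f(x+z) − f(x−z)‖ ≤ 2M₂‖z‖²`
  (two mean-value inequalities);
* `lamK_mul_sq_le` — near-field domination `lamK z · M₂‖z‖² ≤ π⁻²M₂‖z‖⁻²`;
* `integrable_fracLapHalf_integrand` — **`f` continuous, `‖f‖ ≤ M₀`, second differences `≤ M₂‖z‖²` ⇒ for every `x` the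
  integrand of `fracLapHalf f x` is INTEGRABLE on `ℝ³`** (near field: Mathlib `integrableOn_ball_of_norm_le_rpow` with
  `2 < 3`; far field: `4M₀ · lamKTrunc ½`, `integrable_lamKTrunc`);
* `integrable_fracLapHalf_integrand_of_contDiff` — the same from `ContDiff ℝ 2 f` with bounded `f` and bounded
  `iteratedFDeriv ℝ 2 f` (the shape of the door class: slices smooth with the binder's `‖∇²v(s)‖ ≤ K(−s)^{−3/2}`), so
  `IsChiral`, K1's window integrand and K2's window clause carry no Bochner junk on door-class slices (typing-checklist
  4c(ii) answered by a theorem).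

Texts and proofs: nsreg-p1 g16 (`r19/SecondDiff.lean` 483ab14753528e82, `r19/LambdaWellDefined.lean` bf6bb6694f452d4f),
landed here with credit over the tree substrate; the `ContDiff` corollary is this seat's.  Seat nsreg-p6 g11
(THEOREMS-ONLY door sequels, DIRECTOR-NS g8 #32 (2)/#36).  WHAT THIS IS NOT: not NS regularity (Clay A); not the
analyticity of `Λ(v s)` (the spread stub's one analytic input); no route is opened.
-/

noncomputable section

-- the summit and its single sub-problem share the name (CONVENTIONS §1), as in every Theorems file
set_option linter.dupNamespace false

open Set Metric MeasureTheory

/-! ### Second differences from a `D²` bound (general normed spaces) -/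

namespace Summit.NavierStokesRegularity.NavierStokesRegularity.Theorems.ChiralWindowDoorLambda

/-- **Second-difference bound**: for `f : E → F` of class `C²` with `‖D(Df)‖ ≤ M₂` everywhere,
`‖2f(x) − f(x+z) − f(x−z)‖ ≤ 2M₂‖z‖²` (two applications of the mean value inequality) (nsreg-p1 `r19/SecondDiff.lean`). -/
theorem norm_secondDiff_le {E F : Type*} [NormedAddCommGroup E] [NormedSpace ℝ E] [NormedAddCommGroup F]
    [NormedSpace ℝ F] {f : E → F} {M₂ : ℝ} (hf : ContDiff ℝ 2 f)
    (hM : ∀ y, ‖fderiv ℝ (fderiv ℝ f) y‖ ≤ M₂) (x z : E) :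
    ‖(2 : ℝ) • f x - f (x + z) - f (x - z)‖ ≤ 2 * M₂ * ‖z‖ ^ 2 := by
  have hd : Differentiable ℝ f := hf.differentiable (by norm_num)
  have hd2 : Differentiable ℝ (fderiv ℝ f) :=
    (hf.fderiv_right (m := 1) (by norm_num)).differentiable (by norm_num)
  -- Step 1: the derivative is `M₂`-Lipschitz.
  have hLip : ∀ a b : E, ‖fderiv ℝ f b - fderiv ℝ f a‖ ≤ M₂ * ‖b - a‖ := fun a b =>
    Convex.norm_image_sub_le_of_norm_fderiv_le (fun y _ => hd2 y) (fun y _ => hM y) convex_univ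
      (mem_univ a) (mem_univ b)
  -- Step 2: the second difference `h(w) = 2f(x) − f(x+w) − f(x−w)` has derivative `Df(x−w) − Df(x+w)`.
  set h : E → F := fun w => (2 : ℝ) • f x - f (x + w) - f (x - w) with hh
  have hder : ∀ w, HasFDerivAt h (fderiv ℝ f (x - w) - fderiv ℝ f (x + w)) w := by
    intro w
    have h1 : HasFDerivAt (fun w => f (x + w)) (fderiv ℝ f (x + w)) w := by
      have := (hd (x + w)).hasFDerivAt.comp w ((hasFDerivAt_id w).const_add x)
      simpa [Function.comp_def] using this
    have h2 : HasFDerivAt (fun w => f (x - w)) (-fderiv ℝ f (x - w)) w := by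
      have := (hd (x - w)).hasFDerivAt.comp w ((hasFDerivAt_id w).const_sub x)
      simpa [Function.comp_def] using this
    have h3 : HasFDerivAt h (0 - fderiv ℝ f (x + w) - -fderiv ℝ f (x - w)) w :=
      ((hasFDerivAt_const ((2 : ℝ) • f x) w).sub h1).sub h2
    exact h3.congr_fderiv (by abel)
  have hdiff : ∀ w, DifferentiableAt ℝ h w := fun w => (hder w).differentiableAt
  have hbound : ∀ w ∈ closedBall (0 : E) ‖z‖, ‖fderiv ℝ h w‖ ≤ 2 * M₂ * ‖z‖ := by
    intro w hw
    rw [(hder w).fderiv]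
    have hw' : ‖w‖ ≤ ‖z‖ := by simpa [mem_closedBall, dist_zero_right] using hw
    have hM₂ : 0 ≤ M₂ := le_trans (norm_nonneg (fderiv ℝ (fderiv ℝ f) 0)) (hM 0)
    calc ‖fderiv ℝ f (x - w) - fderiv ℝ f (x + w)‖ ≤ M₂ * ‖(x - w) - (x + w)‖ := hLip _ _
      _ = M₂ * (2 * ‖w‖) := by
          rw [show x - w - (x + w) = -((2 : ℝ) • w) by simp [two_smul]; abel, norm_neg, norm_smul,
            Real.norm_eq_abs, abs_of_pos (by norm_num : (0 : ℝ) < 2)]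
      _ ≤ M₂ * (2 * ‖z‖) := by gcongr
      _ = 2 * M₂ * ‖z‖ := by ring
  have hmv := Convex.norm_image_sub_le_of_norm_fderiv_le (fun w _ => hdiff w) hbound
    (convex_closedBall (0 : E) ‖z‖) (mem_closedBall_self (norm_nonneg z))
    (by simp [mem_closedBall, dist_zero_right] : z ∈ closedBall (0 : E) ‖z‖)
  have h0 : h 0 = 0 := by simp [hh, two_smul]
  rw [h0, sub_zero, sub_zero] at hmv
  calc ‖(2 : ℝ) • f x - f (x + z) - f (x - z)‖ = ‖h z‖ := rfl
    _ ≤ 2 * M₂ * ‖z‖ * ‖z‖ := hmv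
    _ = 2 * M₂ * ‖z‖ ^ 2 := by ring

/-! ### The `Λ`-integrand is integrable on bounded fields with quadratic second differences -/

open Summit.NavierStokesRegularity.NavierStokesRegularity.Theorems.ChiralWindowDoorDefs

/-- Near-field domination: `lamK z · M₂‖z‖² ≤ π⁻² M₂ ‖z‖^{−2}` (both sides `0` at `z = 0`). -/
theorem lamK_mul_sq_le {M₂ : ℝ} (hM : 0 ≤ M₂) (z : EuclideanSpace ℝ (Fin 3)) :
    lamK z * (M₂ * ‖z‖ ^ 2) ≤ (1 / Real.pi ^ 2 * M₂) * ‖z‖ ^ (-(2 : ℝ)) := by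
  by_cases hz : z = 0
  · subst hz; simp [lamK]; positivity
  · have hn : 0 < ‖z‖ := norm_pos_iff.2 hz
    rw [Real.rpow_neg hn.le, show (2 : ℝ) = ((2 : ℕ) : ℝ) by norm_num, Real.rpow_natCast]
    unfold lamK
    have : ‖z‖ ^ 2 ≠ 0 := by positivity
    have : ‖z‖ ^ 4 ≠ 0 := by positivity
    rw [show ‖z‖ ^ 4 = ‖z‖ ^ 2 * ‖z‖ ^ 2 by ring]
    field_simp
    exact le_rfl

/-- **Integrability of the `Λ`-integrand** for bounded continuous fields with a quadratic second-difference bound. -/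
theorem integrable_fracLapHalf_integrand {f : EuclideanSpace ℝ (Fin 3) → EuclideanSpace ℝ (Fin 3)} {M₀ M₂ : ℝ} (hfc : Continuous f)
    (hf0 : ∀ x, ‖f x‖ ≤ M₀) (hf2 : ∀ x z, ‖(2 : ℝ) • f x - f (x + z) - f (x - z)‖ ≤ M₂ * ‖z‖ ^ 2) (x : EuclideanSpace ℝ (Fin 3)) :
    Integrable (fun z => lamK z • ((2 : ℝ) • f x - f (x + z) - f (x - z))) := by
  have hM₀ : 0 ≤ M₀ := (norm_nonneg _).trans (hf0 x)
  have hM₂ : 0 ≤ M₂ := by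
    by_contra h
    push Not at h
    obtain ⟨z, hz⟩ : ∃ z : EuclideanSpace ℝ (Fin 3), z ≠ 0 := exists_ne 0
    have h1 := hf2 x z
    have : M₂ * ‖z‖ ^ 2 < 0 := mul_neg_of_neg_of_pos h (by positivity)
    linarith [norm_nonneg ((2 : ℝ) • f x - f (x + z) - f (x - z))]
  set F : EuclideanSpace ℝ (Fin 3) → EuclideanSpace ℝ (Fin 3) := fun z => lamK z • ((2 : ℝ) • f x - f (x + z) - f (x - z)) with hF
  have hmeas : AEStronglyMeasurable F volume := by
    have hm : Measurable F := measurable_lamK.smul (by fun_prop)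
    exact hm.aestronglyMeasurable
  -- near field
  have hball : IntegrableOn F (ball 0 1) volume := by
    refine integrableOn_ball_of_norm_le_rpow (E := EuclideanSpace ℝ (Fin 3)) (F := EuclideanSpace ℝ (Fin 3)) (μ := volume)
      (by rw [finrank_euclideanSpace_fin]; norm_num) (C := 1 / Real.pi ^ 2 * M₂) (α := 2) (r := 1)
      (by rw [finrank_euclideanSpace_fin]; norm_num) (ae_of_all _ fun z => ?_) hmeas
    calc ‖F z‖ = lamK z * ‖(2 : ℝ) • f x - f (x + z) - f (x - z)‖ := by
            rw [hF]; simp only; rw [norm_smul, Real.norm_eq_abs, abs_of_nonneg (lamK_nonneg z)]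
      _ ≤ lamK z * (M₂ * ‖z‖ ^ 2) := mul_le_mul_of_nonneg_left (hf2 x z) (lamK_nonneg z)
      _ ≤ (1 / Real.pi ^ 2 * M₂) * ‖z‖ ^ (-(2 : ℝ)) := lamK_mul_sq_le hM₂ z
  -- far field
  have hfar : IntegrableOn F (ball 0 1)ᶜ volume := by
    have hdom : Integrable (fun z => 4 * M₀ * lamKTrunc (1 / 2) z) :=
      (integrable_lamKTrunc (by norm_num : (0 : ℝ) < 1 / 2)).const_mul _
    refine hdom.integrableOn.mono' hmeas.restrict ?_
    refine (ae_restrict_iff' (measurableSet_ball.compl)).2 (ae_of_all _ fun z hz => ?_)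
    have hz1 : 1 ≤ ‖z‖ := by simpa [mem_ball, dist_zero_right] using hz
    have hK : lamKTrunc (1 / 2) z = lamK z := by
      unfold lamKTrunc; rw [if_pos (by linarith)]
    have hD : ‖(2 : ℝ) • f x - f (x + z) - f (x - z)‖ ≤ 4 * M₀ := by
      calc ‖(2 : ℝ) • f x - f (x + z) - f (x - z)‖
          ≤ ‖(2 : ℝ) • f x‖ + ‖f (x + z)‖ + ‖f (x - z)‖ := by
            calc _ ≤ ‖(2 : ℝ) • f x - f (x + z)‖ + ‖f (x - z)‖ := norm_sub_le _ _
              _ ≤ _ := by gcongr; exact norm_sub_le _ _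
        _ ≤ 2 * M₀ + M₀ + M₀ := by
            rw [norm_smul, Real.norm_eq_abs, abs_of_pos (by norm_num : (0 : ℝ) < 2)]
            gcongr <;> exact hf0 _
        _ = 4 * M₀ := by ring
    calc ‖F z‖ = lamK z * ‖(2 : ℝ) • f x - f (x + z) - f (x - z)‖ := by
            rw [hF]; simp only; rw [norm_smul, Real.norm_eq_abs, abs_of_nonneg (lamK_nonneg z)]
      _ ≤ lamK z * (4 * M₀) := mul_le_mul_of_nonneg_left hD (lamK_nonneg z)
      _ = 4 * M₀ * lamKTrunc (1 / 2) z := by rw [hK]; ring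
  have h := hball.union hfar
  rwa [union_compl_self, integrableOn_univ] at h

/-- **The `Λ`-integrand of a bounded `C²` field with bounded second derivative is integrable** (the door-class shape:
slices are smooth, bounded by the Type-I rate, with `‖∇²v(s)‖ ≤ K(−s)^{−3/2}` from R19's binder / the class). -/
theorem integrable_fracLapHalf_integrand_of_contDiff
    {f : EuclideanSpace ℝ (Fin 3) → EuclideanSpace ℝ (Fin 3)} {M₀ M₂ : ℝ} (hf : ContDiff ℝ 2 f)
    (hf0 : ∀ x, ‖f x‖ ≤ M₀) (hf2 : ∀ x, ‖iteratedFDeriv ℝ 2 f x‖ ≤ M₂) (x : EuclideanSpace ℝ (Fin 3)) :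
    Integrable (fun z => lamK z • ((2 : ℝ) • f x - f (x + z) - f (x - z))) := by
  -- `‖D(Df)(y)‖ = ‖iteratedFDeriv ℝ 2 f y‖` (tree: `…Theorems.norm_fderiv_fderiv_eq_norm_iteratedFDeriv_two`, inlined)
  have hM : ∀ y, ‖fderiv ℝ (fderiv ℝ f) y‖ ≤ M₂ := fun y => by
    rw [← norm_iteratedFDeriv_one (𝕜 := ℝ) (fderiv ℝ f), norm_iteratedFDeriv_fderiv]; exact hf2 y
  exact integrable_fracLapHalf_integrand hf.continuous hf0 (fun x z => norm_secondDiff_le hf hM x z) x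

end Summit.NavierStokesRegularity.NavierStokesRegularity.Theorems.ChiralWindowDoorLambda
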